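import Summits.AtomisticToContinuum.Crystallization.Theorems.ChargedEnergyGap.Negative.BlocksBound
import Literature.Geometry.DiscreteGeometry.BondGraph

/-!
# Blocks of a periodic configuration IV: deep block points keep their local structure

For a periodic configuration `Q` of `ℝ³`: nearest neighbours exist and nearest-neighbour
distances / charge are invariant under the periods (`exists_nearestDist_eq`,
`nearestDist_transl`, `isChargeFree_transl`), all nearest-neighbour distances are `≤ nnMax`;
and in the blocks of part I, block points whose lattice coordinates are deep enough
(`lvl1 ≤ lvl2 ≤ lvl3`, multiples of `depth(2·nnMax + 1)`) have the same nearest-neighbour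
distance, bonds, neighbour sets and CHARGE as in the infinite configuration
(`nearestDist_block_eq`, `adj_block_iff`, `neighborSet_block_eq`, `isChargeFree_block_iff`;
tolerance `0 ≤ η ≤ 1`).  Used by part PeriodicFormConverse.  All `[folklore]`.
-/

noncomputable section

namespace Summit.AtomisticToContinuum.Crystallization.Theorems.ChargedEnergyGapNegative

open Literature.MathematicalPhysics.StatisticalMechanics
open Literature.Geometry.DiscreteGeometry
open Summit.AtomisticToContinuum.Crystallization.Theses.PricedLinkCensus
open scoped BigOperators

namespace Blocks

variable (Q : PeriodicConfiguration 3)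

/-! ### The infinite configuration: nearest neighbours exist, translation invariance -/

/-- The points of `Q` as a configuration indexed by themselves. [folklore] -/
abbrev ptConfig : Q.points → E3 := Subtype.val

/-- A non-zero period. [folklore] -/
theorem latVec_one_ne_zero : latVec Q (fun _ => 1) ≠ 0 := by
  intro h
  have := latVec_injective Q (h.trans (latVec_zero Q).symm)
  have := congrFun this 0
  simp at this

/-- Every point of `Q` has another point of `Q`. [folklore] -/
theorem exists_ne_pt (p : Q.points) : ∃ q : Q.points, q ≠ p :=
  ⟨⟨p.1 + latVec Q (fun _ => 1), Q.add_mem_points p.2 (latVec_mem Q _)⟩, fun h => by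
    have := congrArg Subtype.val h
    simp only at this
    exact latVec_one_ne_zero Q (by simpa using this)⟩

/-- **Nearest neighbours exist in `Q`** (local finiteness): the nearest-neighbour distance of a
point of `Q` is attained and positive. [folklore] -/
theorem exists_nearestDist_eq (p : Q.points) :
    ∃ q : Q.points, q ≠ p ∧ nearestDist (ptConfig Q) p = dist p.1 q.1 := by
  obtain ⟨q₀, hq₀⟩ := exists_ne_pt Q p
  have hq₀' : q₀.1 ≠ p.1 := fun h => hq₀ (Subtype.ext h)
  set r := dist p.1 q₀.1 with hr
  have hfin := Q.finite_inter_points (Metric.isBounded_closedBall (x := p.1) (r := r))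
  -- the other points of `Q` in the closed ball, as a finite set
  set T : Finset E3 := (hfin.toFinset.filter fun q => q ≠ p.1) with hT
  have hq₀T : q₀.1 ∈ T := by
    rw [hT, Finset.mem_filter, Set.Finite.mem_toFinset]
    exact ⟨⟨Metric.mem_closedBall.2 (by rw [dist_comm]), q₀.2⟩, hq₀'⟩
  obtain ⟨q, hqT, hmin⟩ := T.exists_min_image (fun q => dist p.1 q) ⟨q₀.1, hq₀T⟩
  rw [hT, Finset.mem_filter, Set.Finite.mem_toFinset] at hqT
  obtain ⟨⟨hqball, hqpts⟩, hqne⟩ := hqT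
  refine ⟨⟨q, hqpts⟩, fun h => hqne (congrArg Subtype.val h), le_antisymm ?_ ?_⟩
  · exact nearestDist_le_dist (ptConfig Q) (j := p) (k := ⟨q, hqpts⟩)
      (fun h => hqne (congrArg Subtype.val h))
  · refine le_nearestDist ⟨q₀, hq₀⟩ fun q' hq' => ?_
    by_cases hball : dist p.1 q'.1 ≤ r
    · have hq'T : q'.1 ∈ T := by
        rw [hT, Finset.mem_filter, Set.Finite.mem_toFinset]
        exact ⟨⟨Metric.mem_closedBall.2 (by rw [dist_comm]; exact hball), q'.2⟩,
          fun h => hq' (Subtype.ext h)⟩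
      exact hmin q'.1 hq'T
    · push Not at hball
      have : dist p.1 q ≤ r := by rw [dist_comm]; exact Metric.mem_closedBall.1 hqball
      exact (this.trans hball.le)

/-- The nearest-neighbour distance in `Q` is positive. [folklore] -/
theorem nearestDist_pt_pos (p : Q.points) : 0 < nearestDist (ptConfig Q) p := by
  obtain ⟨q, hq, h⟩ := exists_nearestDist_eq Q p
  rw [h]
  exact dist_pos.2 fun h' => hq (Subtype.ext h'.symm)

/-- Translation of the points by a period, as a permutation of `Q.points`. [folklore] -/
def transl {g : E3} (hg : g ∈ Q.lattice) : Q.points ≃ Q.points where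
  toFun q := ⟨q.1 + g, Q.add_mem_points q.2 hg⟩
  invFun q := ⟨q.1 - g, by
    have := Q.add_mem_points q.2 (Q.lattice.neg_mem hg)
    simpa [sub_eq_add_neg] using this⟩
  left_inv q := Subtype.ext (by simp)
  right_inv q := Subtype.ext (by simp)

/-- Translating the whole configuration by `g` is the same as relabelling by `transl`. [folklore] -/
theorem ptConfig_comp_transl {g : E3} (hg : g ∈ Q.lattice) :
    ptConfig Q ∘ transl Q hg = (fun v : E3 => v + g) ∘ ptConfig Q := by
  funext q; rfl

/-- **Translation invariance of nearest-neighbour distances in `Q`.** [folklore] -/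
theorem nearestDist_transl {g : E3} (hg : g ∈ Q.lattice) (p : Q.points) :
    nearestDist (ptConfig Q) (transl Q hg p) = nearestDist (ptConfig Q) p := by
  rw [← nearestDist_comp_equiv (ptConfig Q) (transl Q hg) p, ptConfig_comp_transl,
    nearestDist_comp_isometry (isometry_add_right g)]

/-- **Translation invariance of charge in `Q`.** [folklore] -/
theorem isChargeFree_transl (η : ℝ) {g : E3} (hg : g ∈ Q.lattice) (p : Q.points) :
    IsChargeFree η (ptConfig Q) (transl Q hg p) ↔ IsChargeFree η (ptConfig Q) p := by
  rw [← isChargeFree_comp_equiv_iff η (ptConfig Q) (transl Q hg) p, ptConfig_comp_transl,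
    isChargeFree_comp_isometry_iff (isometry_add_right g)]

/-- An upper bound for all nearest-neighbour distances of `Q`: the sum over the motif. [folklore] -/
def nnMax : ℝ := ∑ x : Q.motif, nearestDist (ptConfig Q) ⟨x.1, Q.mem_points_of_mem_motif x.2⟩

/-- `0 ≤ nnMax`. [folklore] -/
theorem nnMax_nonneg : 0 ≤ nnMax Q := Finset.sum_nonneg fun _ _ => nearestDist_nonneg _ _

/-- **Every nearest-neighbour distance of `Q` is at most `nnMax`.** [folklore] -/
theorem nearestDist_le_nnMax (p : Q.points) : nearestDist (ptConfig Q) p ≤ nnMax Q := by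
  obtain ⟨x, hx, g, hg, hp⟩ := p.2
  have hpt : p = transl Q hg ⟨x, Q.mem_points_of_mem_motif hx⟩ := Subtype.ext (by simp [transl, hp])
  rw [hpt, nearestDist_transl]
  have := Finset.single_le_sum (s := Finset.univ)
    (f := fun x : Q.motif => nearestDist (ptConfig Q) ⟨x.1, Q.mem_points_of_mem_motif x.2⟩)
    (fun _ _ => nearestDist_nonneg _ _) (Finset.mem_univ ⟨x, hx⟩)
  exact this

/-- Bonds of `Q` are short: `dist ≤ (1 + η)·nn ≤ 2·nnMax` for `η ≤ 1`. [folklore] -/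
theorem dist_le_of_adj_pt {η : ℝ} (hη1 : η ≤ 1) {p q : Q.points}
    (h : (bondGraph η (ptConfig Q)).Adj p q) : dist p.1 q.1 ≤ 2 * nnMax Q := by
  obtain ⟨-, hle⟩ := bondGraph_adj.1 h
  have h1 : min (nearestDist (ptConfig Q) p) (nearestDist (ptConfig Q) q) ≤ nnMax Q :=
    (min_le_left _ _).trans (nearestDist_le_nnMax Q p)
  have h0 : 0 ≤ min (nearestDist (ptConfig Q) p) (nearestDist (ptConfig Q) q) :=
    le_min (nearestDist_nonneg _ _) (nearestDist_nonneg _ _)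
  calc dist p.1 q.1 ≤ (1 + η) * min (nearestDist (ptConfig Q) p) (nearestDist (ptConfig Q) q) := hle
    _ ≤ 2 * nnMax Q := mul_le_mul (by linarith) h1 h0 (by norm_num)


/-! ### Block points as points of `Q`; deep points keep their local structure -/

variable (K : ℕ)

/-- Block points as points of `Q`. [folklore] -/
def toP (u : BIdx Q K) : Q.points := ⟨bpt Q K u, bpt_mem Q K u⟩

/-- Its value. [folklore] -/
@[simp] theorem val_toP (u : BIdx Q K) : (toP Q K u).1 = bpt Q K u := rfl

/-- `toP` is injective. [folklore] -/
theorem toP_injective : Function.Injective (toP Q K) :=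
  fun _ _ h => bpt_injective Q K (congrArg Subtype.val h)

/-- **Lattice coordinates of block points differ by at most `Λ·(dist + 2D_F)`.** [folklore] -/
theorem abs_coords_sub_le (u v : BIdx Q K) (i : Fin 3) :
    |((coords K u.2 i : ℤ) : ℝ) - ((coords K v.2 i : ℤ) : ℝ)| ≤
      coordBound Q * (dist (bpt Q K u) (bpt Q K v) + 2 * motifSize Q) := by
  have hlat := abs_le_coordBound_mul_norm_latVec Q (coords K u.2 - coords K v.2) i
  simp only [Pi.sub_apply, Int.cast_sub] at hlat
  have hvec : latVec Q (coords K u.2 - coords K v.2) = (bpt Q K u - bpt Q K v) + (v.1 - u.1) := by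
    rw [latVec_sub]; simp only [bpt]; abel
  have hnorm : ‖latVec Q (coords K u.2 - coords K v.2)‖ ≤
      dist (bpt Q K u) (bpt Q K v) + 2 * motifSize Q := by
    rw [hvec, dist_eq_norm]
    exact (norm_add_le _ _).trans (add_le_add le_rfl (norm_sub_le_two_motifSize Q v.1.2 u.1.2))
  exact hlat.trans (mul_le_mul_of_nonneg_left hnorm (coordBound_nonneg Q))

/-- Deepness is monotone in the depth. [folklore] -/
theorem IsDeep.mono {d d' : ℕ} (h : d ≤ d') {k : Fin 3 → Fin K} (hk : IsDeep K d' k) :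
    IsDeep K d k := fun i => ⟨h.trans (hk i).1, by have := (hk i).2; omega⟩

/-- **Points near a deep point are deep**: if `u` is `(d + depth r)`-deep and `v` is within
distance `r`, then `v` is `d`-deep. [folklore] -/
theorem isDeep_of_near {d : ℕ} {r : ℝ} {u v : BIdx Q K} (hu : IsDeep K (d + depth Q r) u.2)
    (hdist : dist (bpt Q K u) (bpt Q K v) ≤ r) : IsDeep K d v.2 := by
  intro i
  have hb := abs_coords_sub_le Q K u v i
  have hceil : coordBound Q * (r + 2 * motifSize Q) ≤ (depth Q r : ℝ) := Nat.le_ceil _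
  have hΛ := coordBound_nonneg Q
  have hle : |((coords K u.2 i : ℤ) : ℝ) - ((coords K v.2 i : ℤ) : ℝ)| ≤ (depth Q r : ℝ) :=
    hb.trans ((mul_le_mul_of_nonneg_left (by linarith) hΛ).trans hceil)
  rw [abs_le] at hle
  obtain ⟨h1, h2⟩ := hle
  simp only [coords] at h1 h2
  have hu1 := (hu i).1
  have hu2 := (hu i).2
  have h1' : ((u.2 i : ℕ) : ℝ) - (depth Q r : ℝ) ≤ ((v.2 i : ℕ) : ℝ) := by push_cast at h1 h2 ⊢; linarith
  have h2' : ((v.2 i : ℕ) : ℝ) ≤ ((u.2 i : ℕ) : ℝ) + (depth Q r : ℝ) := by push_cast at h1 h2 ⊢; linarith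
  have h1'' : (u.2 i : ℕ) ≤ (v.2 i : ℕ) + depth Q r := by exact_mod_cast (by linarith : ((u.2 i : ℕ) : ℝ) ≤ ((v.2 i : ℕ) : ℝ) + (depth Q r : ℝ))
  have h2'' : (v.2 i : ℕ) ≤ (u.2 i : ℕ) + depth Q r := by exact_mod_cast h2'
  constructor <;> omega

/-- For a `(depth ρ)`-deep block point, every point of `Q` within distance `< ρ` is a block
point. [folklore] -/
theorem exists_eq_toP_of_dist_lt {ρ : ℝ} {u : BIdx Q K} (hdeep : IsDeep K (depth Q ρ) u.2)
    (q : Q.points) (hne : q ≠ toP Q K u) (hlt : dist (bpt Q K u) q.1 < ρ) :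
    ∃ v : BIdx Q K, v ≠ u ∧ toP Q K v = q := by
  have hq' : q.1 ≠ bpt Q K u := fun h => hne (Subtype.ext h)
  set q' : {q : E3 // q ∈ Q.points ∧ q ≠ bpt Q K u} := ⟨q.1, q.2, hq'⟩ with hq'def
  by_cases hmem : q' ∈ blockOthers Q K u
  · unfold blockOthers at hmem
    obtain ⟨v, -, hv⟩ := Finset.mem_image.1 hmem
    refine ⟨v.1, Finset.ne_of_mem_erase v.2, Subtype.ext ?_⟩
    have := congrArg Subtype.val hv
    simpa [hq'def] using this
  · exact absurd (le_dist_of_deep Q K hdeep q' hmem) (not_le.2 hlt)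

/-- The other block points bound the block nearest-neighbour distance from below by the one in
`Q`. [folklore] -/
theorem nearestDist_pt_le_block (u : BIdx Q K) (hex : ∃ v : BIdx Q K, v ≠ u) :
    nearestDist (ptConfig Q) (toP Q K u) ≤ nearestDist (bpt Q K) u := by
  refine le_nearestDist hex fun v hv => ?_
  have hne : toP Q K v ≠ toP Q K u := fun h => hv (toP_injective Q K h)
  have h := nearestDist_le_dist (ptConfig Q) hne
  have e1 : ptConfig Q (toP Q K u) = bpt Q K u := rfl
  have e2 : ptConfig Q (toP Q K v) = bpt Q K v := rfl
  rw [e1, e2] at h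
  exact h

/-- **Deep block points have the nearest-neighbour distance of `Q`** (`ρ > nnMax`). [folklore] -/
theorem nearestDist_block_eq {ρ : ℝ} (hρ : nnMax Q < ρ) {u : BIdx Q K}
    (hdeep : IsDeep K (depth Q ρ) u.2) :
    nearestDist (bpt Q K) u = nearestDist (ptConfig Q) (toP Q K u) := by
  obtain ⟨q, hq, hqd⟩ := exists_nearestDist_eq Q (toP Q K u)
  have hlt : dist (bpt Q K u) q.1 < ρ := by
    have := nearestDist_le_nnMax Q (toP Q K u)
    rw [hqd] at this
    exact lt_of_le_of_lt this hρ
  obtain ⟨v, hv, rfl⟩ := exists_eq_toP_of_dist_lt Q K hdeep q hq hlt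
  apply le_antisymm
  · have h1 : nearestDist (bpt Q K) u ≤ dist (bpt Q K u) (bpt Q K v) := nearestDist_le_dist _ hv
    have e : dist (toP Q K u).1 (toP Q K v).1 = dist (bpt Q K u) (bpt Q K v) := rfl
    rw [hqd, e]
    exact h1
  · exact nearestDist_pt_le_block Q K u ⟨v, hv⟩

/-- **Deep pairs are bonded in the block iff they are bonded in `Q`.** [folklore] -/
theorem adj_block_iff {η ρ : ℝ} (hρ : nnMax Q < ρ) {u v : BIdx Q K}
    (hu : IsDeep K (depth Q ρ) u.2) (hv : IsDeep K (depth Q ρ) v.2) :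
    (bondGraph η (bpt Q K)).Adj u v ↔ (bondGraph η (ptConfig Q)).Adj (toP Q K u) (toP Q K v) := by
  rw [bondGraph_adj, bondGraph_adj, nearestDist_block_eq Q K hρ hu, nearestDist_block_eq Q K hρ hv]
  simp only [val_toP, ne_eq]
  exact and_congr_left fun _ => ⟨fun h h' => h (toP_injective Q K h'), fun h h' => h (by rw [h'])⟩

/-- The clearance used below: `ρ₀ = 2·nnMax + 1` (exceeds `nnMax` and all bond lengths). -/
def clearance : ℝ := 2 * nnMax Q + 1

/-- `nnMax < ρ₀`. [folklore] -/
theorem nnMax_lt_clearance : nnMax Q < clearance Q := by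
  unfold clearance; linarith [nnMax_nonneg Q]

/-- Depth level 1: `depth ρ₀`. [folklore] -/
def lvl1 : ℕ := depth Q (clearance Q)

/-- Depth level 2: one more clearance. [folklore] -/
def lvl2 : ℕ := lvl1 Q + depth Q (clearance Q)

/-- Depth level 3: two more clearances. [folklore] -/
def lvl3 : ℕ := lvl2 Q + depth Q (clearance Q)

/-- Bonds at a level-1-deep block point are at most `ρ₀` long (in the block). [folklore] -/
theorem dist_le_clearance_of_adj_block {η : ℝ} (hη0 : 0 ≤ η) (hη1 : η ≤ 1) {u v : BIdx Q K}
    (hu1 : IsDeep K (lvl1 Q) u.2) (hadj : (bondGraph η (bpt Q K)).Adj u v) :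
    dist (bpt Q K u) (bpt Q K v) ≤ clearance Q := by
  have h1 := dist_le_of_adj (by linarith : (0 : ℝ) ≤ 1 + η) hadj
  have h2 : nearestDist (bpt Q K) u ≤ nnMax Q := by
    rw [nearestDist_block_eq Q K (nnMax_lt_clearance Q) hu1]; exact nearestDist_le_nnMax Q _
  have h3 : (1 + η) * nearestDist (bpt Q K) u ≤ 2 * nnMax Q :=
    mul_le_mul (by linarith) h2 (nearestDist_nonneg _ _) (by norm_num)
  unfold clearance; linarith

/-- Bonds of `Q` at a block point are shorter than `ρ₀`. [folklore] -/
theorem dist_lt_clearance_of_adj_pt {η : ℝ} (hη1 : η ≤ 1) {u : BIdx Q K} {q : Q.points}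
    (hadj : (bondGraph η (ptConfig Q)).Adj (toP Q K u) q) : dist (bpt Q K u) q.1 < clearance Q := by
  have hd := dist_le_of_adj_pt Q hη1 hadj
  have e : dist (toP Q K u).1 q.1 = dist (bpt Q K u) q.1 := rfl
  rw [e] at hd
  unfold clearance; linarith

/-- **Neighbour sets of level-2-deep block points are those of `Q`** (`0 ≤ η ≤ 1`). [folklore] -/
theorem neighborSet_block_eq {η : ℝ} (hη0 : 0 ≤ η) (hη1 : η ≤ 1) {u : BIdx Q K}
    (hu : IsDeep K (lvl2 Q) u.2) :
    (bondGraph η (ptConfig Q)).neighborSet (toP Q K u) =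
      toP Q K '' (bondGraph η (bpt Q K)).neighborSet u := by
  have hu1 : IsDeep K (lvl1 Q) u.2 := IsDeep.mono K (Nat.le_add_right _ _) hu
  ext q
  rw [SimpleGraph.mem_neighborSet, Set.mem_image]
  constructor
  · intro hadj
    have hlt := dist_lt_clearance_of_adj_pt Q K hη1 hadj
    obtain ⟨v, -, hvq⟩ := exists_eq_toP_of_dist_lt Q K hu1 q hadj.ne.symm hlt
    subst hvq
    have hv1 : IsDeep K (lvl1 Q) v.2 := isDeep_of_near Q K hu hlt.le
    refine ⟨v, ?_, rfl⟩
    rw [SimpleGraph.mem_neighborSet]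
    exact (adj_block_iff Q K (nnMax_lt_clearance Q) hu1 hv1).2 hadj
  · rintro ⟨v, hadj, rfl⟩
    rw [SimpleGraph.mem_neighborSet] at hadj
    have hd := dist_le_clearance_of_adj_block Q K hη0 hη1 hu1 hadj
    have hv1 : IsDeep K (lvl1 Q) v.2 := isDeep_of_near Q K hu hd
    exact (adj_block_iff Q K (nnMax_lt_clearance Q) hu1 hv1).1 hadj

/-- **Charge of level-3-deep block points is the charge in `Q`** (`0 ≤ η ≤ 1`). [folklore] -/
theorem isChargeFree_block_iff {η : ℝ} (hη0 : 0 ≤ η) (hη1 : η ≤ 1) {u : BIdx Q K}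
    (hu : IsDeep K (lvl3 Q) u.2) :
    IsChargeFree η (bpt Q K) u ↔ IsChargeFree η (ptConfig Q) (toP Q K u) := by
  have hu2 : IsDeep K (lvl2 Q) u.2 := IsDeep.mono K (Nat.le_add_right _ _) hu
  have hu1 : IsDeep K (lvl1 Q) u.2 := IsDeep.mono K (Nat.le_add_right _ _) hu2
  -- neighbours of `u` are level-2-deep
  have hN2 : ∀ j ∈ (bondGraph η (bpt Q K)).neighborSet u, IsDeep K (lvl2 Q) j.2 := by
    intro j hj
    rw [SimpleGraph.mem_neighborSet] at hj
    exact isDeep_of_near Q K hu (dist_le_clearance_of_adj_block Q K hη0 hη1 hu1 hj)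
  rw [isChargeFree_iff, isChargeFree_iff, neighborSet_block_eq Q K hη0 hη1 hu2,
    Set.ncard_image_of_injective _ (toP_injective Q K), Set.forall_mem_image]
  refine and_congr_right fun _ => forall₂_congr fun j hj => ?_
  rw [ringNumber_def, ringNumber_def, neighborSet_block_eq Q K hη0 hη1 hu2,
    neighborSet_block_eq Q K hη0 hη1 (hN2 j hj), ← Set.image_inter (toP_injective Q K),
    Set.ncard_image_of_injective _ (toP_injective Q K)]

end Blocks

end Summit.AtomisticToContinuum.Crystallization.Theorems.ChargedEnergyGapNegative

end
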